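import Literature.Topology.FourManifolds.TrisectionsSectorOneDecomposition
import HarnessLib

/-!
# The handle decomposition of the third sector of the Morse-theoretic trisection

Topic `Literature/Topology/FourManifolds`; step F (part ii, third sector) of a Morse-theoretic
construction of Gay–Kirby's trisection for the fact seat
`provefact-Literature.Topology.FourManifolds.exists_isBalancedGKTrisection` (Gay–Kirby 2016,
Thm. 4 via §4, Lemma 14).  Everything in this file is **proved**; no new definitions.

For the third sector `X₃ = {T ≤ 2s, T ≤ s}` the function `ψ₃ = 1 - C U₃(s - T/2) V₃(s - T)`
(`HandleBoxes.psiThreeBot`) is fed into `CornerSliceAtlas.hasHandleDecomposition_of_comp_val`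
over `D.atlas₃` exactly as for the first sector (`TrisectionsSectorOneDecomposition.lean`):
corner form `1 - (C/2)(2uv)` along `F`, `= 1` on the faces, `< 1` inside, regular on the faces
and without critical points on the band part (`HandleBoxes.not_isMCriticalPt_psiThreeBot`,
here in the form with the regularity of `f` as hypothesis), and above the band the Morse data
of `-f` (`HandleBoxes.morseData_psiThreeBot_above`).  Result (`hasHandleDecomposition_S₃`):
**`HasHandleDecomposition 3 ↥X₃ c` with `c i` the number of critical points `z` of `f` above
the band with `index_f z + i = 4`** — for a self-indexing `f` on a closed `4`-manifold with
one maximum and `k` critical points of index `3` this is `handleCount 1 k` ("`X₃ ≅ ♮ᵏ S¹ × B³`",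
the `3`- and `4`-handles read upside down).

## References

* D. Gay, R. Kirby, *Trisecting 4-manifolds*, Geom. Topol. 20 (2016), §4, Lemma 14. [GayKirby2016]
* J. Milnor, *Morse theory* (1963), Thm. 3.1 and §3. [Milnor1963]
* J. Milnor, *Lectures on the h-cobordism theorem* (1965), proof of Thm. 9.1 (turning about). [MilnorHCobordism1965]
-/

open scoped Manifold ContDiff Topology
open Set Function Filter

noncomputable section

universe u

namespace Literature.Topology.FourManifolds

open Flow

/-- Local notation: `𝔼 n` is the model Euclidean space `EuclideanSpace ℝ (Fin n)`. -/
local notation "𝔼 " n:arg => EuclideanSpace ℝ (Fin n)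

variable {X : Type u} [TopologicalSpace X] [T2Space X] [CompactSpace X] [ChartedSpace (𝔼 4) X]
  [IsManifold (𝓡 4) ∞ X]

namespace HandleBoxes

variable {f : X → ℝ} {ξ : Π x : X, TangentSpace (𝓡 4) x} {a η : ℝ} {ι : Type} [Fintype ι]
  (H : HandleBoxes f ξ a η ι)
  {hξ : ContMDiff (𝓡 4) (𝓡 4).tangent ∞ fun x => (⟨x, ξ x⟩ : TangentBundle (𝓡 4) X)}
  {h : IsRegularLevel (𝓡 4) f a} {φ : RegularLevel h → ℝ} {h₂ TP χlo χhi U₃ V₃ : ℝ → ℝ}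
  {Spl Sbot Smin Psw C : ℝ}

/-- `not_isMCriticalPt_psiThreeBot` with the regularity of `f` at the point as hypothesis. [cite: GayKirby2016, §4, Lemma 14] -/
theorem not_isMCriticalPt_psiThreeBot' (hgl : IsGradientLike (𝓡 4) f ξ) (hfM : IsMorse (𝓡 4) f)
    (hT : ContMDiff (𝓡 4) 𝓘(ℝ, ℝ) ∞ (H.topHeight hξ h φ h₂ TP χlo χhi Spl Smin Psw))
    (hχlo : ContDiff ℝ ∞ χlo) (hχhi : ContDiff ℝ ∞ χhi)
    {P₁ v₁ : ℝ} (hPsw0 : 0 < Psw) (hPsw : 2 * Psw ≤ η ^ 2) (hP₁ : 2 * P₁ < Psw)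
    (hTP₂ : ∀ P, 2 * P₁ ≤ P → TP P = Spl) (hh₂v : ∀ t ≤ v₁, h₂ t = Spl)
    (hφv : ∀ j (y : RegularLevel h), y.1 ∈ (H.box j).chart.source → H.P j y.1 < 2 * Psw → φ y ≤ v₁)
    (hU : ContDiff ℝ ∞ U₃) (hV : ContDiff ℝ ∞ V₃) (hC : C ≠ 0)
    {z : X} (hf₁ : a - η < f z) (hf₂ : f z < a + 2 * η) (hz : ¬ IsMCriticalPt (𝓡 4) f z)
    (hD : H.topCoeffBot hξ h φ h₂ TP χlo χhi Spl Sbot Smin Psw z ≤ 0)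
    (hUz : 0 ≤ U₃ ((f z - a) - H.topHeightBot hξ h φ h₂ TP χlo χhi Spl Sbot Smin Psw z / 2))
    (hU'z : 0 ≤ deriv U₃ ((f z - a) - H.topHeightBot hξ h φ h₂ TP χlo χhi Spl Sbot Smin Psw z / 2))
    (hVz : 0 ≤ V₃ ((f z - a) - H.topHeightBot hξ h φ h₂ TP χlo χhi Spl Sbot Smin Psw z))
    (hV'z : 0 ≤ deriv V₃ ((f z - a) - H.topHeightBot hξ h φ h₂ TP χlo χhi Spl Sbot Smin Psw z))
    (hpos : 0 < deriv U₃ ((f z - a) - H.topHeightBot hξ h φ h₂ TP χlo χhi Spl Sbot Smin Psw z / 2) *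
        V₃ ((f z - a) - H.topHeightBot hξ h φ h₂ TP χlo χhi Spl Sbot Smin Psw z) +
      U₃ ((f z - a) - H.topHeightBot hξ h φ h₂ TP χlo χhi Spl Sbot Smin Psw z / 2) *
        deriv V₃ ((f z - a) - H.topHeightBot hξ h φ h₂ TP χlo χhi Spl Sbot Smin Psw z)) :
    ¬ IsMCriticalPt (𝓡 4) (H.psiThreeBot hξ h φ h₂ TP χlo χhi Spl Sbot Smin Psw U₃ V₃ C) z := by
  rw [psiThreeBot_eq]
  set Tb := H.topHeightBot hξ h φ h₂ TP χlo χhi Spl Sbot Smin Psw with hTb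
  obtain ⟨hΓd, h10, h01⟩ := gammaThree_partials hU hV a (Tb z, f z)
  have hfd : fderiv ℝ (fun r : ℝ × ℝ => 1 - C * (U₃ ((r.2 - a) - r.1 / 2) * V₃ ((r.2 - a) - r.1))) (Tb z, f z) =
      (-C) • fderiv ℝ (fun r : ℝ × ℝ => U₃ ((r.2 - a) - r.1 / 2) * V₃ ((r.2 - a) - r.1)) (Tb z, f z) := by
    rw [fderiv_const_sub, fderiv_const_mul hΓd, ← neg_smul]
  refine H.not_isMCriticalPt_comp₂_bot_of_ne hgl hfM hT hχlo hχhi hPsw0 hPsw hP₁ hTP₂ hh₂v hφv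
    (contDiff_gammaThree' hU hV C a) ?_ hz hf₁ hf₂
  rw [hfd]
  simp only [FunLike.coe_smul, Pi.smul_apply, smul_eq_mul, h10, h01]
  have hterm : 0 ≤ -(deriv U₃ ((f z - a) - Tb z / 2) * V₃ ((f z - a) - Tb z) / 2 +
      U₃ ((f z - a) - Tb z / 2) * deriv V₃ ((f z - a) - Tb z)) * H.topCoeffBot hξ h φ h₂ TP χlo χhi Spl Sbot Smin Psw z := by
    have h1 : 0 ≤ deriv U₃ ((f z - a) - Tb z / 2) * V₃ ((f z - a) - Tb z) / 2 +
        U₃ ((f z - a) - Tb z / 2) * deriv V₃ ((f z - a) - Tb z) := by positivity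
    nlinarith
  intro h0
  have : -C * (-(deriv U₃ ((f z - a) - Tb z / 2) * V₃ ((f z - a) - Tb z) / 2 +
        U₃ ((f z - a) - Tb z / 2) * deriv V₃ ((f z - a) - Tb z)) * H.topCoeffBot hξ h φ h₂ TP χlo χhi Spl Sbot Smin Psw z +
      (deriv U₃ ((f z - a) - Tb z / 2) * V₃ ((f z - a) - Tb z) + U₃ ((f z - a) - Tb z / 2) * deriv V₃ ((f z - a) - Tb z))) = 0 := by
    linarith [h0]
  rcases mul_eq_zero.1 this with h' | h'
  · exact hC (neg_eq_zero.1 h')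
  · linarith

end HandleBoxes

variable (B : BiCollar X) {η : ℝ} {ι : Type} [Fintype ι] {ζ : Π x : X, TangentSpace (𝓡 4) x}
  (H : HandleBoxes B.f ζ B.a η ι) {hζ : ContMDiff (𝓡 4) (𝓡 4).tangent ∞ fun x => (⟨x, ζ x⟩ : TangentBundle (𝓡 4) X)}
  {h₂ TP χlo χhi U₃ V₃ : ℝ → ℝ} {Spl Sbot Smin Psw C : ℝ} (D : B.TwoFnData)

namespace BiCollar.TwoFnData

/-- **The handle decomposition of the third sector.**  Hypotheses as for the first sector, with
the above-band analysis (`χ_hi = 0` beyond `S_hi < 2η`, `U₃ = 1` far out, `V₃' > 0`), the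
plateau containing `[0, S_hi]`, and: the only critical points of `f` with value in
`[a - η, a + 2η)` are the `cpt j`, none of which lies in `X₃` (`T(c_j) > η`).
Conclusion: `HasHandleDecomposition 3 ↥X₃ c`, `c i = #{z | crit f, index_f z + i = 4, a + 2η ≤ f z}`.
[cite: GayKirby2016, §4, Lemma 14] [cite: Milnor1963, Thm. 3.1 and §3] -/
theorem hasHandleDecomposition_S₃ (hgl : IsGradientLike (𝓡 4) B.f ζ) (hfM : IsMorse (𝓡 4) B.f)
    (hDT : D.T = H.topHeightBot hζ B.hf B.g h₂ TP χlo χhi Spl Sbot Smin Psw)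
    (hT : ContMDiff (𝓡 4) 𝓘(ℝ, ℝ) ∞ (H.topHeight hζ B.hf B.g h₂ TP χlo χhi Spl Smin Psw))
    (hχlo : ContDiff ℝ ∞ χlo) (hχhi : ContDiff ℝ ∞ χhi)
    {P₁ v₁ : ℝ} (hPsw0 : 0 < Psw) (hPsw : 2 * Psw ≤ η ^ 2) (hP₁ : 2 * P₁ < Psw)
    (hTP₂ : ∀ P, 2 * P₁ ≤ P → TP P = Spl) (hh₂v : ∀ t ≤ v₁, h₂ t = Spl)
    (hφv : ∀ j (y : RegularLevel B.hf), y.1 ∈ (H.box j).chart.source → H.P j y.1 < 2 * Psw → B.g y ≤ v₁)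
    (hU : ContDiff ℝ ∞ U₃) (hV : ContDiff ℝ ∞ V₃) (hC : 0 < C)
    (hD : ∀ z, B.a - η < B.f z → B.f z < B.a + 2 * η →
      H.topCoeffBot hζ B.hf B.g h₂ TP χlo χhi Spl Sbot Smin Psw z ≤ 0)
    (hU_id : ∀ u ∈ Ico 0 ((1 + D.lam / 2) * D.εw), U₃ u = u) (hV_id : ∀ v ∈ Ico 0 ((1 + D.lam) * D.εw), V₃ v = v)
    (hUpos : ∀ u, 0 < u → 0 < U₃ u) (hVpos : ∀ v, 0 < v → 0 < V₃ v)
    (hU' : ∀ u, 0 ≤ u → 0 ≤ deriv U₃ u) (hV' : ∀ v, 0 ≤ v → 0 ≤ deriv V₃ v)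
    (hface : ∀ u v, 0 ≤ u → 0 ≤ v → (0 < u ∨ 0 < v) → 0 < deriv U₃ u * V₃ v + U₃ u * deriv V₃ v)
    {Shi σ₀ : ℝ} (hσ₀ : 0 < σ₀) (hShi : Shi + σ₀ < 2 * η)
    (habove_cut : ∀ s, Shi < s → χlo s = 1 ∧ χhi s = 0)
    (habove_U : ∀ u, Shi < u → U₃ u = 1)
    (habove_V' : ∀ v, 0 < deriv V₃ v)
    (hTge : ∀ z, -Smin ≤ D.T z) (hSmin : Smin < 2 * η) (hSmin0 : 0 ≤ Smin)
    (hcpt : ∀ j, H.cpt j ∉ D.S₃)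
    (hcrit_above : ∀ z, IsMCriticalPt (𝓡 4) B.f z → B.a + 2 * η ≤ B.f z → Shi + Smin < B.f z - B.a) :
    letI := D.atlas₃.chartedSpace
    HasHandleDecomposition 3 D.S₃ fun i =>
      {z | IsMCriticalPt (𝓡 4) B.f z ∧ morseIndex (𝓡 4) B.f z + i = 4 ∧ B.a + 2 * η ≤ B.f z}.ncard := by
  letI := D.atlas₃.chartedSpace
  have hη := H.eta_pos
  set ψ := H.psiThreeBot hζ B.hf B.g h₂ TP χlo χhi Spl Sbot Smin Psw U₃ V₃ C with hψ
  have hTbc : ContMDiff (𝓡 4) 𝓘(ℝ, ℝ) ∞ (H.topHeightBot hζ B.hf B.g h₂ TP χlo χhi Spl Sbot Smin Psw) :=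
    H.contMDiff_topHeightBot hfM hχlo hT
  have hψ_apply : ∀ z, ψ z = 1 - C * (U₃ ((B.f z - B.a) - D.T z / 2) * V₃ ((B.f z - B.a) - D.T z)) := by
    intro z; simp only [hψ, HandleBoxes.psiThreeBot, hDT]
  have hψc : ContMDiff (𝓡 4) 𝓘(ℝ, ℝ) ∞ ψ := by
    have hs : ContMDiff (𝓡 4) 𝓘(ℝ, ℝ) ∞ fun z => B.f z - B.a := hfM.contMDiff.sub contMDiff_const
    have : ψ = fun z => 1 - C * (U₃ ((B.f z - B.a) - H.topHeightBot hζ B.hf B.g h₂ TP χlo χhi Spl Sbot Smin Psw z / 2) *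
        V₃ ((B.f z - B.a) - H.topHeightBot hζ B.hf B.g h₂ TP χlo χhi Spl Sbot Smin Psw z)) := by
      funext z; simp only [hψ, HandleBoxes.psiThreeBot]
    rw [this]
    exact contMDiff_const.sub (contMDiff_const.mul ((hU.contMDiff.comp (hs.sub (hTbc.div_const 2))).mul
      (hV.contMDiff.comp (hs.sub hTbc))))
  -- points of `X₃` are above `a - η`
  have hS₃_band : ∀ z ∈ D.S₃, B.a - η < B.f z := by
    intro z hz; have := hTge z; have := hz.1; linarith
  -- critical points of `f` in `X₃` below `a + 2η` do not exist
  have hnocritf : ∀ z ∈ D.S₃, B.f z < B.a + 2 * η → ¬ IsMCriticalPt (𝓡 4) B.f z := by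
    intro z hz hlt hc
    obtain ⟨j, rfl⟩ := H.crit_val z hc (hS₃_band z hz).le hlt
    exact hcpt j hz
  -- the no-critical-point lemma for `ψ` on the band part
  have hnocrit : ∀ z ∈ D.S₃, B.f z < B.a + 2 * η → 0 ≤ (B.f z - B.a) - D.T z / 2 → 0 ≤ (B.f z - B.a) - D.T z →
      (0 < (B.f z - B.a) - D.T z / 2 ∨ 0 < (B.f z - B.a) - D.T z) → ¬ IsMCriticalPt (𝓡 4) ψ z := by
    intro z hz hf₂ hu hv huv
    have hf₁ := hS₃_band z hz
    have hDT' : D.T z = H.topHeightBot hζ B.hf B.g h₂ TP χlo χhi Spl Sbot Smin Psw z := by rw [hDT]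
    refine H.not_isMCriticalPt_psiThreeBot' hgl hfM hT hχlo hχhi hPsw0 hPsw hP₁ hTP₂ hh₂v hφv hU hV hC.ne' hf₁ hf₂
      (hnocritf z hz hf₂) (hD z hf₁ hf₂) ?_ ?_ ?_ ?_ ?_
    · rw [← hDT']
      rcases hu.eq_or_lt with h0 | h0
      · rw [← h0, hU_id 0 ⟨le_rfl, by have := D.lam_pos; have := D.εw_pos; positivity⟩]
      · exact (hUpos _ h0).le
    · rw [← hDT']; exact hU' _ hu
    · rw [← hDT']
      rcases hv.eq_or_lt with h0 | h0
      · rw [← h0, hV_id 0 ⟨le_rfl, by have := D.lam_pos; have := D.εw_pos; positivity⟩]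
      · exact (hVpos _ h0).le
    · rw [← hDT']; exact hV' _ hv
    · rw [← hDT']; exact hface _ _ hu hv huv
  -- above the band
  have habove : ∀ z, Shi < B.f z - B.a →
      (IsMCriticalPt (𝓡 4) ψ z ↔ IsMCriticalPt (𝓡 4) B.f z) ∧
        (IsMCriticalPt (𝓡 4) B.f z → (mhessian (𝓡 4) ψ z).Nondegenerate ∧
          morseIndex (𝓡 4) ψ z + morseIndex (𝓡 4) B.f z = 4) := by
    intro z hz
    refine H.morseData_psiThreeBot_above hfM hV hC ?_ ?_ (habove_V' _)
    · exact Filter.mem_of_superset (Ioi_mem_nhds hz) fun s hs => habove_cut s hs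
    · have : Ioi Shi ∈ 𝓝 ((B.f z - B.a) + Smin / 2) := Ioi_mem_nhds (by linarith)
      exact Filter.mem_of_superset this fun u hu => habove_U u hu
  -- `T = -Smin` above
  have hT_above : ∀ z, Shi < B.f z - B.a → D.T z = -Smin := by
    intro z hz
    rw [hDT]; exact H.topHeightBot_of_hi (habove_cut _ hz).1 (habove_cut _ hz).2
  refine D.atlas₃.hasHandleDecomposition_of_comp_val (F := ψ) (fun q _ _ => hψc q)
    (fun p hp => ?_) (fun p hb => ?_) (fun p hb hpK => ?_) (fun p hi => ?_) (fun p hi hc => ?_) (fun i => ?_)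
  · -- corner form
    refine ⟨cornerOuter C, (contDiff_cornerOuter C).contDiffAt, fderiv_cornerOuter_ne_zero hC.ne' _, fun q hq hqS => ?_⟩
    have hqb : q ∈ B.box D.εw := hq.1
    rw [cornerOuter_cornerFold, (D.atlas₃.cornerDatum p hp).apply_zero q hq, (D.atlas₃.cornerDatum p hp).apply_one q hq,
      uFun_W₃, vFun_W₃, hψ_apply, D.T_box q hqb]
    obtain ⟨hs, hr⟩ := (mem_box_iff).1 hqb
    have hu : 0 ≤ B.sFun q + D.lam / 2 * B.rFun q := by
      have := ((D.mem_S₃_iff_of_mem_box q hqb).1 hqS).1; rw [uFun_W₃] at this; exact this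
    have hv : 0 ≤ B.sFun q + D.lam * B.rFun q := by
      have := ((D.mem_S₃_iff_of_mem_box q hqb).1 hqS).2; rw [vFun_W₃] at this; exact this
    have hlam := D.lam_pos
    have h1 := abs_lt.1 hs; have h2 := abs_lt.1 hr
    have hU1 : U₃ ((B.f q - B.a) - -D.lam * B.rFun q / 2) = B.sFun q + D.lam / 2 * B.rFun q := by
      rw [show (B.f q - B.a) - -D.lam * B.rFun q / 2 = B.sFun q + D.lam / 2 * B.rFun q by rw [BiCollar.sFun]; ring]
      exact hU_id _ ⟨hu, by nlinarith⟩
    have hV1 : V₃ ((B.f q - B.a) - -D.lam * B.rFun q) = B.sFun q + D.lam * B.rFun q := by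
      rw [show (B.f q - B.a) - -D.lam * B.rFun q = B.sFun q + D.lam * B.rFun q by rw [BiCollar.sFun]; ring]
      exact hV_id _ ⟨hv, by nlinarith⟩
    rw [hU1, hV1]
  · -- `= 1` on the boundary
    rcases (D.isBoundaryPoint₃_iff p).1 hb with h0 | h0
    · rw [hψ_apply, show (B.f p.1 - B.a) - D.T p.1 = 0 by linarith, hV_id 0 ⟨le_rfl, by
        have := D.lam_pos; have := D.εw_pos; positivity⟩]; ring
    · rw [hψ_apply, show (B.f p.1 - B.a) - D.T p.1 / 2 = 0 by linarith, hU_id 0 ⟨le_rfl, by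
        have := D.lam_pos; have := D.εw_pos; positivity⟩]; ring
  · -- regular on the boundary off `F`
    have hp := p.2
    have hbandhi : B.f p.1 < B.a + 2 * η := by
      -- a boundary point has `T = s` or `T = 2s`; above `Shi` we have `T = -Smin < 0 ≤ …`
      by_contra hge; push Not at hge
      have hs : Shi < B.f p.1 - B.a := by linarith
      have hT' := hT_above p.1 hs
      rcases (D.isBoundaryPoint₃_iff p).1 hb with h0 | h0 <;> linarith
    rcases (D.isBoundaryPoint₃_iff p).1 hb with h0 | h0
    · -- face `T = s`, `T < 2s`
      have h2 : D.T p.1 < 2 * (B.f p.1 - B.a) := by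
        rcases hp.1.eq_or_lt with h | h
        · exact absurd (D.surface_of p.1 (by linarith) (by linarith)) hpK
        · exact h
      exact hnocrit p.1 hp hbandhi (by linarith) (by linarith) (Or.inl (by linarith))
    · -- face `T = 2s`, `T < s`
      have h2 : D.T p.1 < B.f p.1 - B.a := by
        rcases hp.2.eq_or_lt with h | h
        · exact absurd (D.surface_of p.1 (by linarith) (by linarith)) hpK
        · exact h
      exact hnocrit p.1 hp hbandhi (by linarith) (by linarith) (Or.inr (by linarith))
  · -- `< 1` inside
    obtain ⟨h1, h2⟩ := (D.isInteriorPoint₃_iff p).1 hi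
    rw [hψ_apply]
    have := mul_pos (hUpos _ (by linarith : 0 < (B.f p.1 - B.a) - D.T p.1 / 2))
      (hVpos _ (by linarith : 0 < (B.f p.1 - B.a) - D.T p.1))
    nlinarith
  · -- nondegenerate at interior critical points
    obtain ⟨h1, h2⟩ := (D.isInteriorPoint₃_iff p).1 hi
    by_cases hband : B.f p.1 < B.a + 2 * η
    · exact absurd hc (hnocrit p.1 p.2 hband (by linarith) (by linarith) (Or.inl (by linarith)))
    · push Not at hband
      obtain ⟨hiff, hdata⟩ := habove p.1 (by linarith)
      exact (hdata (hiff.1 hc)).1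
  · -- counts
    congr 1
    ext x
    simp only [mem_inter_iff, mem_image, mem_criticalSetOfIndex, mem_setOf_eq]
    constructor
    · rintro ⟨⟨p, hpi, rfl⟩, hc, hidx⟩
      obtain ⟨h1, h2⟩ := (D.isInteriorPoint₃_iff p).1 hpi
      have hband : ¬ (B.f p.1 < B.a + 2 * η) := fun hb =>
        hnocrit p.1 p.2 hb (by linarith) (by linarith) (Or.inl (by linarith)) hc
      push Not at hband
      obtain ⟨hiff, hdata⟩ := habove p.1 (by linarith)
      have hcf := hiff.1 hc
      refine ⟨hcf, ?_, hband⟩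
      have := (hdata hcf).2; rw [hidx] at this; linarith
    · rintro ⟨hcf, hidx, hge⟩
      have hs : Shi + Smin < B.f x - B.a := hcrit_above x hcf hge
      have hT' := hT_above x (by linarith)
      have hxS : x ∈ D.S₃ := ⟨by rw [hT']; linarith, by rw [hT']; linarith⟩
      have hint : (𝓡∂ 4).IsInteriorPoint (⟨x, hxS⟩ : D.S₃) :=
        (D.isInteriorPoint₃_iff ⟨x, hxS⟩).2 ⟨by show D.T x < 2 * (B.f x - B.a); rw [hT']; linarith, by
          show D.T x < B.f x - B.a; rw [hT']; linarith⟩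
      obtain ⟨hiff, hdata⟩ := habove x (by linarith)
      refine ⟨⟨⟨x, hxS⟩, hint, rfl⟩, hiff.2 hcf, ?_⟩
      have := (hdata hcf).2; omega

end BiCollar.TwoFnData

end Literature.Topology.FourManifolds

end
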